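import Summits.ABC.ABC.Theses.FeketeScales
import Literature.NumberTheory.DiophantineGeometry.AbcQualityProofs

/-!
# `SparseGoodScales` (stmt-ABC-2161): EVERY large radical scale carries an abc triple of height
# `> K · R`, for every constant `K`

Negative support lemma for the crux `Summit.ABC.ABC.Theses.FeketeScales.SparseGoodScales`
(cdisprove seat, cycle 1).  With `G(R) := max {c : (a,b,c) abc triple, rad(abc) ≤ R}` the crux reads
`liminf_R log G(R) / log R ≤ 1`.  This file proves the complementary UNCONDITIONAL fact

  `liminf_R G(R) / R = +∞`, i.e. `∀ K ∃ N ∀ R ≥ N ∃ abc triple : rad ≤ R ∧ K·R < c`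
  (`exists_triple_gt_mul_at_scale`, real form `exists_triple_gt_real_mul_at_scale`),

which improves the lead's "Dirichlet side" `SubmultOfRST.exists_triple_at_scale` (`R < 4c` at every
scale `R ≥ 4`) to `K·R < c` eventually, for every `K`; the consequences for the crux (`δ ≤ 0`
excluded, no linear good scales, no scales good uniformly in `δ`) are drawn in
`Negative/LinearScalesFail.lean`.

Mechanism (a covering chain, the only shape a disproof of the crux could have — here realised one
logarithm below the crux): for `m = 12K+1` Euler gives `2^e ≡ 3^e ≡ 1 (mod m²)`, `e = φ(m²)`;
Dirichlet's approximation theorem (`Real.exists_int_int_abs_mul_sub_le`) gives `k ≥ 1`, `j ≥ 1` with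
`0 < |k log 2 − j log 3| ≤ (log 2)/e`, hence a RATIONAL STEP `g = P^s/Q^t ∈ (1, 2]`, `{P,Q} = {2,3}`,
`e ∣ s`, `e ∣ t`; the geometric chain `cᵢ = P^{si} Q^{t(H−i)}` (`i = 0..H`, `H = ⌊log R / log Q^t⌋`) starts
below `R`, ends above `R` and has ratio `≤ 2`, so some member `c ≡ 1 (mod m²)` lies in `(KR, 2KR]`;
the triple `(1, c−1, c)` has `rad ≤ 6·rad(c−1) ≤ 6(c−1)/m < R`.
-/

noncomputable section

namespace Summit.ABC.ABC.Theorems.SparseGoodScales.Negative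

open Literature.NumberTheory.DiophantineGeometry UniqueFactorizationMonoid

/-! ## Arithmetic of the witness triples `(1, c - 1, c)` -/

/-- The radical of `P^x · Q^y` divides `P · Q`. [folklore] -/
theorem radical_pow_mul_pow_dvd (P Q x y : ℕ) : radical (P ^ x * Q ^ y) ∣ P * Q := by
  have hP : radical (P ^ x) ∣ P := by
    rcases eq_or_ne x 0 with rfl | hx
    · simp
    · rw [radical_pow _ hx]; exact radical_dvd_self
  have hQ : radical (Q ^ y) ∣ Q := by
    rcases eq_or_ne y 0 with rfl | hy
    · simp
    · rw [radical_pow _ hy]; exact radical_dvd_self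
  exact radical_mul_dvd.trans (mul_dvd_mul hP hQ)

/-- If `m² ∣ b` with `b > 0` then `radical b · m ≤ b` (any `m`, prime or not). [folklore] -/
theorem radical_mul_le_of_sq_dvd {m b : ℕ} (hb : 0 < b) (hmb : m ^ 2 ∣ b) :
    radical b * m ≤ b := by
  obtain ⟨t, ht⟩ := hmb
  have h1 : radical b ∣ m * t := by
    rw [ht]
    calc radical (m ^ 2 * t) ∣ radical (m ^ 2) * radical t := radical_mul_dvd
      _ = radical m * radical t := by rw [radical_pow _ two_ne_zero]
      _ ∣ m * t := mul_dvd_mul radical_dvd_self radical_dvd_self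
  have hmt : 0 < m * t := by
    rcases Nat.eq_zero_or_pos (m * t) with h | h
    · exfalso
      have : b = m * (m * t) := by rw [ht]; ring
      rw [this, h, mul_zero] at hb
      exact lt_irrefl 0 hb
    · exact h
  calc radical b * m ≤ m * t * m := Nat.mul_le_mul_right m (Nat.le_of_dvd hmt h1)
    _ = b := by rw [ht]; ring

/-- The witness triple: if `c ≥ 2`, `m² ∣ c − 1` and `radical c ∣ 6`, then `(1, c − 1, c)` is an abc
triple with `rad(1·(c−1)·c) · m ≤ 6 (c − 1)`. [folklore] -/
theorem isABCTriple_one_pred_and_rad_le {c m : ℕ} (hc : 2 ≤ c) (hmc : m ^ 2 ∣ c - 1)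
    (hrc : radical c ∣ 6) :
    IsABCTriple 1 (c - 1) c ∧ rad 1 (c - 1) c * m ≤ 6 * (c - 1) := by
  refine ⟨⟨one_pos, by omega, by omega, Nat.coprime_one_left _⟩, ?_⟩
  have hb : 0 < c - 1 := by omega
  have h1 : rad 1 (c - 1) c ∣ radical (c - 1) * 6 := by
    rw [rad_def, one_mul]
    exact radical_mul_dvd.trans (mul_dvd_mul_left _ hrc)
  have h2 : rad 1 (c - 1) c ≤ radical (c - 1) * 6 :=
    Nat.le_of_dvd (Nat.mul_pos (Nat.radical_pos _) (by norm_num)) h1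
  calc rad 1 (c - 1) c * m ≤ radical (c - 1) * 6 * m := Nat.mul_le_mul_right m h2
    _ = radical (c - 1) * m * 6 := by ring
    _ ≤ (c - 1) * 6 := Nat.mul_le_mul_right 6 (radical_mul_le_of_sq_dvd hb hmc)
    _ = 6 * (c - 1) := by ring

/-! ## The chain lemma -/

/-- **Chain lemma.** If `Q ≥ 2`, `t ≥ 1` and `Q^t < P^s ≤ 2 · Q^t` (a rational step in `(1, 2]`),
then every large `R` has a product `P^x · Q^y ∈ (R, 2R]` with `s ∣ x` and `t ∣ y`. [folklore] -/
theorem exists_pow_mul_pow_mem_Ioc {P Q s t : ℕ} (hQ : 2 ≤ Q) (ht : 1 ≤ t)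
    (hlt : Q ^ t < P ^ s) (hle : P ^ s ≤ 2 * Q ^ t) :
    ∃ N : ℕ, ∀ R : ℕ, N ≤ R →
      ∃ x y : ℕ, s ∣ x ∧ t ∣ y ∧ R < P ^ x * Q ^ y ∧ P ^ x * Q ^ y ≤ 2 * R := by
  set A := P ^ s with hA
  set B := Q ^ t with hB
  have hB2 : 2 ≤ B := by
    calc 2 ≤ Q := hQ
      _ = Q ^ 1 := (pow_one Q).symm
      _ ≤ Q ^ t := Nat.pow_le_pow_right (by omega) ht
  have hB0 : 0 < B := by omega
  -- an exponent `H₀` with `B^(H₀+1) < A^H₀`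
  obtain ⟨H₀, hH₀⟩ : ∃ H₀ : ℕ, B ^ (H₀ + 1) < A ^ H₀ := by
    have hratio : (1 : ℝ) < (A : ℝ) / B := by
      rw [one_lt_div (by exact_mod_cast hB0)]; exact_mod_cast hlt
    obtain ⟨n, hn⟩ := pow_unbounded_of_one_lt (B : ℝ) hratio
    refine ⟨n, ?_⟩
    rw [div_pow, lt_div_iff₀ (by positivity)] at hn
    have : (B : ℝ) ^ (n + 1) < (A : ℝ) ^ n := by rw [pow_succ']; linarith
    exact_mod_cast this
  refine ⟨B ^ H₀, fun R hR => ?_⟩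
  have hR0 : R ≠ 0 := by
    have : 0 < B ^ H₀ := pow_pos hB0 _
    omega
  set H := Nat.log B R with hH
  have hH₀H : H₀ ≤ H := Nat.le_log_of_pow_le (by omega) hR
  have hBH : B ^ H ≤ R := Nat.pow_log_le_self B hR0
  have hRB : R < B ^ (H + 1) := Nat.lt_pow_succ_log_self (by omega) R
  -- the chain `c i = A^i B^(H-i)`
  set c : ℕ → ℕ := fun i => A ^ i * B ^ (H - i) with hc
  have hc0 : c 0 ≤ R := by simp [hc, hBH]
  have hcH : R < c H := by
    calc R < B ^ (H + 1) := hRB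
      _ = B ^ (H₀ + 1) * B ^ (H - H₀) := by rw [← pow_add]; congr 1; omega
      _ ≤ A ^ H₀ * A ^ (H - H₀) := Nat.mul_le_mul hH₀.le (Nat.pow_le_pow_left hlt.le _)
      _ = c H := by simp [hc, ← pow_add, Nat.add_sub_cancel' hH₀H]
  have hex : ∃ i, R < c i := ⟨H, hcH⟩
  classical
  have hi₀ : R < c (Nat.find hex) := Nat.find_spec hex
  have hi₀H : Nat.find hex ≤ H := Nat.find_min' hex hcH
  have hi₀0 : Nat.find hex ≠ 0 := by
    intro h
    rw [h] at hi₀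
    exact absurd hc0 (not_le.mpr hi₀)
  obtain ⟨i, hi⟩ : ∃ i, Nat.find hex = i + 1 := ⟨Nat.find hex - 1, by omega⟩
  have hci : c i ≤ R := not_lt.mp (Nat.find_min hex (show i < Nat.find hex by omega))
  have hiH : i + 1 ≤ H := hi ▸ hi₀H
  have hcx : P ^ (s * (i + 1)) * Q ^ (t * (H - (i + 1))) = c (i + 1) := by
    simp [hc, hA, hB, pow_mul]
  refine ⟨s * (i + 1), t * (H - (i + 1)), dvd_mul_right _ _, dvd_mul_right _ _, ?_, ?_⟩
  · rw [hcx, ← hi]; exact hi₀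
  · have hstep : c (i + 1) * B = A * c i := by
      have hsub : H - i = (H - (i + 1)) + 1 := by omega
      simp only [hc, hsub, pow_succ]
      ring
    have hmul : c (i + 1) * B ≤ 2 * R * B := by
      calc c (i + 1) * B = A * c i := hstep
        _ ≤ (2 * B) * R := Nat.mul_le_mul hle hci
        _ = 2 * R * B := by ring
    rw [hcx]
    exact Nat.le_of_mul_le_mul_right hmul hB0

/-! ## The rational step from Dirichlet's approximation theorem -/

/-- **A step in `(1, 2]` made of prescribed powers of `2` and `3`.**  For every `e ≥ 1` there are
`P, Q` with `P · Q = 6`, `Q ≥ 2`, and exponents `s, t ≥ 1` divisible by `e` with `Q^t < P^s ≤ 2·Q^t`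
(Dirichlet's theorem applied to `log 2 / log 3`, plus `2^k ≠ 3^j`). [folklore] -/
theorem exists_step (e : ℕ) (he : 1 ≤ e) :
    ∃ P Q s t : ℕ, P * Q = 6 ∧ 2 ≤ Q ∧ 1 ≤ t ∧ e ∣ s ∧ e ∣ t ∧ Q ^ t < P ^ s ∧ P ^ s ≤ 2 * Q ^ t := by
  have hlog2 : (0 : ℝ) < Real.log 2 := Real.log_pos (by norm_num)
  have hlog3 : (0 : ℝ) < Real.log 3 := Real.log_pos (by norm_num)
  have hlog32 : Real.log 3 < 2 * Real.log 2 := by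
    rw [← Real.log_rpow (by norm_num : (0:ℝ) < 2)]
    exact Real.log_lt_log (by norm_num) (by norm_num)
  -- Dirichlet with n = 2e
  obtain ⟨j, k, hk0, -, hjk⟩ :=
    Real.exists_int_int_abs_mul_sub_le (Real.log 2 / Real.log 3) (n := 2 * e) (by omega)
  -- D := k log 2 - j log 3, |D| ≤ log 3 / (2e+1)
  set D : ℝ := (k : ℝ) * Real.log 2 - (j : ℝ) * Real.log 3 with hD
  have hDabs : |D| * (2 * e + 1) ≤ Real.log 3 := by
    have h1 : |(k : ℝ) * (Real.log 2 / Real.log 3) - j| * (2 * e + 1) ≤ 1 := by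
      have := hjk
      rw [le_div_iff₀ (by positivity)] at this
      exact_mod_cast this
    have h2 : D = ((k : ℝ) * (Real.log 2 / Real.log 3) - j) * Real.log 3 := by
      rw [hD]; field_simp
    rw [h2, abs_mul, abs_of_pos hlog3]
    calc |(k : ℝ) * (Real.log 2 / Real.log 3) - j| * Real.log 3 * (2 * e + 1)
        = |(k : ℝ) * (Real.log 2 / Real.log 3) - j| * (2 * e + 1) * Real.log 3 := by ring
      _ ≤ 1 * Real.log 3 := mul_le_mul_of_nonneg_right h1 hlog3.le
      _ = Real.log 3 := one_mul _
  have he1 : (1 : ℝ) ≤ e := by exact_mod_cast he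
  -- consequences: e|D| ≤ log 2 / ... and |D| < log 2
  have heD : (e : ℝ) * |D| ≤ Real.log 2 := by
    nlinarith [abs_nonneg D]
  have hDlt : |D| < Real.log 2 := by
    nlinarith [abs_nonneg D]
  -- j ≥ 1
  have hk1 : (1 : ℝ) ≤ k := by exact_mod_cast hk0
  have hj1 : 1 ≤ j := by
    by_contra hj
    have hj0 : (j : ℝ) ≤ 0 := by exact_mod_cast (show j ≤ 0 by omega)
    have : Real.log 2 ≤ D := by
      rw [hD]; nlinarith
    linarith [le_abs_self D]
  -- natural exponents
  obtain ⟨k', hk'⟩ : ∃ k' : ℕ, (k : ℤ) = k' := ⟨k.toNat, (Int.toNat_of_nonneg hk0.le).symm⟩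
  obtain ⟨j', hj'⟩ : ∃ j' : ℕ, (j : ℤ) = j' := ⟨j.toNat, (Int.toNat_of_nonneg (by omega)).symm⟩
  have hk'1 : 1 ≤ k' := by omega
  have hj'1 : 1 ≤ j' := by omega
  have hDk : D = (k' : ℝ) * Real.log 2 - (j' : ℝ) * Real.log 3 := by
    rw [hD]
    have h1 : (k : ℝ) = (k' : ℝ) := by exact_mod_cast hk'
    have h2 : (j : ℝ) = (j' : ℝ) := by exact_mod_cast hj'
    rw [h1, h2]
  -- D as a logarithm of the ratio 2^(k') / 3^(j')
  have hpow2 : Real.log ((2 : ℝ) ^ k') = (k' : ℝ) * Real.log 2 := Real.log_pow 2 k'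
  have hpow3 : Real.log ((3 : ℝ) ^ j') = (j' : ℝ) * Real.log 3 := Real.log_pow 3 j'
  have hne : (2 : ℕ) ^ k' ≠ 3 ^ j' := by
    intro h
    have h2 : 2 ∣ 3 ^ j' := h ▸ dvd_pow_self 2 (by omega)
    have := Nat.Prime.dvd_of_dvd_pow Nat.prime_two h2
    omega
  have hD0 : D ≠ 0 := by
    intro h0
    apply hne
    have : Real.log ((2 : ℝ) ^ k') = Real.log ((3 : ℝ) ^ j') := by
      rw [hpow2, hpow3]; linarith [hDk]
    have := Real.log_injOn_pos (Set.mem_Ioi.mpr (by positivity)) (Set.mem_Ioi.mpr (by positivity))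
      this
    exact_mod_cast this
  rcases lt_or_gt_of_ne hD0 with hneg | hpos
  · -- D < 0 : step 3^(e j') / 2^(e k')
    refine ⟨3, 2, e * j', e * k', by norm_num, le_rfl, Nat.le_mul_of_pos_right e (by omega) |>.trans'
      (by omega), dvd_mul_right _ _, dvd_mul_right _ _, ?_, ?_⟩
    · -- 2^(e k') < 3^(e j')
      have : Real.log ((2 : ℝ) ^ (e * k')) < Real.log ((3 : ℝ) ^ (e * j')) := by
        rw [Real.log_pow, Real.log_pow]
        push_cast
        have : (e : ℝ) * ((k' : ℝ) * Real.log 2) < (e : ℝ) * ((j' : ℝ) * Real.log 3) := by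
          apply mul_lt_mul_of_pos_left _ (by positivity)
          linarith [hDk]
        linarith
      have := (Real.log_lt_log_iff (by positivity) (by positivity)).mp this
      exact_mod_cast this
    · -- 3^(e j') ≤ 2 * 2^(e k')
      have habs : |D| = -D := abs_of_neg hneg
      have : Real.log ((3 : ℝ) ^ (e * j')) ≤ Real.log (2 * (2 : ℝ) ^ (e * k')) := by
        rw [Real.log_mul (by norm_num) (by positivity), Real.log_pow, Real.log_pow]
        push_cast
        have : (e : ℝ) * ((j' : ℝ) * Real.log 3) - (e : ℝ) * ((k' : ℝ) * Real.log 2) ≤ Real.log 2 := by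
          have : (e : ℝ) * (-D) ≤ Real.log 2 := habs ▸ heD
          rw [hDk] at this; linarith
        linarith
      have := (Real.log_le_log_iff (by positivity) (by positivity)).mp this
      exact_mod_cast this
  · -- D > 0 : step 2^(e k') / 3^(e j')
    refine ⟨2, 3, e * k', e * j', by norm_num, by norm_num, Nat.le_mul_of_pos_right e (by omega)
      |>.trans' (by omega), dvd_mul_right _ _, dvd_mul_right _ _, ?_, ?_⟩
    · have : Real.log ((3 : ℝ) ^ (e * j')) < Real.log ((2 : ℝ) ^ (e * k')) := by
        rw [Real.log_pow, Real.log_pow]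
        push_cast
        have : (e : ℝ) * ((j' : ℝ) * Real.log 3) < (e : ℝ) * ((k' : ℝ) * Real.log 2) := by
          apply mul_lt_mul_of_pos_left _ (by positivity)
          linarith [hDk]
        linarith
      have := (Real.log_lt_log_iff (by positivity) (by positivity)).mp this
      exact_mod_cast this
    · have habs : |D| = D := abs_of_pos hpos
      have : Real.log ((2 : ℝ) ^ (e * k')) ≤ Real.log (2 * (3 : ℝ) ^ (e * j')) := by
        rw [Real.log_mul (by norm_num) (by positivity), Real.log_pow, Real.log_pow]
        push_cast
        have : (e : ℝ) * ((k' : ℝ) * Real.log 2) - (e : ℝ) * ((j' : ℝ) * Real.log 3) ≤ Real.log 2 := by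
          have : (e : ℝ) * D ≤ Real.log 2 := habs ▸ heD
          rw [hDk] at this; linarith
        linarith
      have := (Real.log_le_log_iff (by positivity) (by positivity)).mp this
      exact_mod_cast this

/-! ## Every large scale carries a triple of height `> K·R` -/

/-- **`liminf_R G(R)/R = +∞`.**  For every `K` there is `N` such that EVERY radical scale `R ≥ N`
admits an abc triple with `rad(abc) ≤ R` and `c > K · R` — namely `(1, c − 1, c)` with
`c = 2^x 3^y ≡ 1 (mod (12K+1)²)` taken from a chain of ratio `≤ 2` through `(KR, 2KR]`. [folklore] -/
theorem exists_triple_gt_mul_at_scale (K : ℕ) :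
    ∃ N : ℕ, ∀ R : ℕ, N ≤ R → ∃ a b c : ℕ, IsABCTriple a b c ∧ rad a b c ≤ R ∧ K * R < c := by
  wlog hK : 1 ≤ K generalizing K
  · obtain ⟨N, hN⟩ := this 1 le_rfl
    refine ⟨N, fun R hR => ?_⟩
    obtain ⟨a, b, c, h, hr, hc⟩ := hN R hR
    exact ⟨a, b, c, h, hr, lt_of_le_of_lt (Nat.mul_le_mul_right R (by omega)) hc⟩
  -- the modulus m = 12K + 1, coprime to 6
  set m : ℕ := 12 * K + 1 with hm
  have hm6 : Nat.Coprime 6 m := by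
    have : m = 6 * (2 * K) + 1 := by rw [hm]; ring
    rw [this]
    exact (Nat.coprime_mul_left_add_right 6 1 (2 * K)).mpr (Nat.coprime_one_right 6)
  have h2m : Nat.Coprime 2 (m ^ 2) :=
    (Nat.Coprime.coprime_dvd_left (by norm_num : 2 ∣ 6) hm6).pow_right 2
  have h3m : Nat.Coprime 3 (m ^ 2) :=
    (Nat.Coprime.coprime_dvd_left (by norm_num : 3 ∣ 6) hm6).pow_right 2
  set e : ℕ := Nat.totient (m ^ 2) with he
  have he1 : 1 ≤ e := Nat.totient_pos.mpr (by positivity)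
  have h2e : 2 ^ e ≡ 1 [MOD m ^ 2] := Nat.ModEq.pow_totient h2m
  have h3e : 3 ^ e ≡ 1 [MOD m ^ 2] := Nat.ModEq.pow_totient h3m
  -- the step and the chain
  obtain ⟨P, Q, s, t, hPQ, hQ, ht, hes, het, hlt, hle⟩ := exists_step e he1
  have hPe : P ^ e ≡ 1 [MOD m ^ 2] ∧ Q ^ e ≡ 1 [MOD m ^ 2] := by
    -- {P, Q} = {2, 3}
    have hP1 : 1 ≤ P := by
      rcases Nat.eq_zero_or_pos P with rfl | h
      · simp at hPQ
      · exact h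
    have hP3 : P ≤ 3 := by nlinarith
    interval_cases P
    · exfalso
      rw [one_pow] at hlt
      have := Nat.one_le_pow t Q (by omega)
      omega
    · have : Q = 3 := by omega
      subst this; exact ⟨h2e, h3e⟩
    · have : Q = 2 := by omega
      subst this; exact ⟨h3e, h2e⟩
  obtain ⟨N₀, hN₀⟩ := exists_pow_mul_pow_mem_Ioc hQ ht hlt hle
  refine ⟨max N₀ 1, fun R hR => ?_⟩
  have hR1 : 1 ≤ R := le_trans (le_max_right _ _) hR
  have hKR : N₀ ≤ K * R := le_trans (le_trans (le_max_left _ _) hR) (Nat.le_mul_of_pos_left R hK)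
  obtain ⟨x, y, hsx, hty, hlow, hup⟩ := hN₀ (K * R) hKR
  set c : ℕ := P ^ x * Q ^ y with hc
  -- c ≡ 1 mod m²
  have hcmod : c ≡ 1 [MOD m ^ 2] := by
    obtain ⟨x', rfl⟩ := hsx
    obtain ⟨y', rfl⟩ := hty
    obtain ⟨s', rfl⟩ := hes
    obtain ⟨t', rfl⟩ := het
    have h1 : P ^ (e * s' * x') ≡ 1 [MOD m ^ 2] := by
      rw [mul_assoc, pow_mul]
      simpa using hPe.1.pow (s' * x')
    have h2 : Q ^ (e * t' * y') ≡ 1 [MOD m ^ 2] := by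
      rw [mul_assoc, pow_mul]
      simpa using hPe.2.pow (t' * y')
    simpa [hc] using h1.mul h2
  have hc2 : 2 ≤ c := by
    have : K * R ≥ 1 := Nat.le_mul_of_pos_left R hK |>.trans' hR1
    omega
  have hmc : m ^ 2 ∣ c - 1 := (Nat.modEq_iff_dvd' (by omega)).mp hcmod.symm
  have hrc : radical c ∣ 6 := hPQ ▸ radical_pow_mul_pow_dvd P Q x y
  obtain ⟨htriple, hrad⟩ := isABCTriple_one_pred_and_rad_le hc2 hmc hrc
  refine ⟨1, c - 1, c, htriple, ?_, hlow⟩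
  -- rad * m ≤ 6 (c - 1) < 12 K R + R = m R
  have h1 : rad 1 (c - 1) c * m < R * m := by
    calc rad 1 (c - 1) c * m ≤ 6 * (c - 1) := hrad
      _ < 6 * (2 * (K * R)) + R := by omega
      _ = R * m := by rw [hm]; ring
  exact (Nat.lt_of_mul_lt_mul_right h1).le

/-- Real-constant form of `exists_triple_gt_mul_at_scale`. [folklore] -/
theorem exists_triple_gt_real_mul_at_scale (K : ℝ) :
    ∃ N : ℕ, ∀ R : ℕ, N ≤ R → ∃ a b c : ℕ, IsABCTriple a b c ∧ rad a b c ≤ R ∧ K * R < (c : ℝ) := by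
  obtain ⟨N, hN⟩ := exists_triple_gt_mul_at_scale ⌈K⌉₊
  refine ⟨N, fun R hR => ?_⟩
  obtain ⟨a, b, c, h, hr, hc⟩ := hN R hR
  refine ⟨a, b, c, h, hr, ?_⟩
  calc K * R ≤ (⌈K⌉₊ : ℝ) * R := mul_le_mul_of_nonneg_right (Nat.le_ceil K) (Nat.cast_nonneg R)
    _ = ((⌈K⌉₊ * R : ℕ) : ℝ) := by push_cast; ring
    _ < c := by exact_mod_cast hc

end Summit.ABC.ABC.Theorems.SparseGoodScales.Negative
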